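import Summits.Ventures.CertifiedManyBodySolver.Downfold.RouterWordScoreNickelateTriple
import Summits.Ventures.CertifiedManyBodySolver.Downfold.RouterWordScoreRiderClass
import Summits.Ventures.CertifiedManyBodySolver.Downfold.RouterScoreTrancheClasses

/-!
# The HELD SLATE of 2026-09-01 in kernel form: the score tables of blocks 62 / 64 BEFORE their letters and numbers
# (Ce pair M178 CeH₁₀ @95 / M179 CeD₉ @120 + the CeH₉ #81 parent @120 column; v7 M198 Sr₂RuO₄-strain100 / M197 La₃Ni₂O₇-filmSLAO)

Venture CertifiedManyBodySolver, cell `pub/hubbard-downfold`, seat hubbard-downfold-score-2 (session g25, 2026-08-31); namespace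
`Summit.Ventures.CertifiedManyBodySolver.Downfold.RouterScore` (continues `RouterWordScoreSingletonTypings.lean` p750409,
`RouterWordScoreRiderClass.lean` p752867, `RouterWordScoreNickelateTriple.lean` p814034 and `RouterScoreTrancheClasses.lean` p812838).
Everything here is PROVED (no `sorry`, standard axioms); nothing here is physics.

The five objects the cell HOLDS for the 2026-09-01 desk (lead g40 RULING R-abr (2) / lead g41 STARTED l.11437 (d); score-2 g24
registrations block62 2026-08-31T06:53Z and block64 07:48Z on `router_score.py` `1e0914bf5b4953c6` / `dd766e442cca0152`, each BEFORE
any letter / GO / number) are typed by the curators with ONE-WORD typings or a dominated pair, so every receipt the successor seat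
will write is a line of a closed form already in the tree. This file states those lines as theorems now, so that «as registered
and by theorem» is mechanical when the words land:

* §1 (any head alphabet) `outcome_bare_with_rider` — the pair «q ∣ q+s» (a bare primary and the same primary with ONE rider typed
  as a secondary) scores every print like the bare «q» (`outcome_append_redundant` p744404 with `dominates_head_cons` p814034);
  `outcome_bare_with_rider_closed` (the one-token closed form of p750409 behind it).
* §2 the Ce pair under EPH-ONLY «EPH» (M178 'ceh10', M179 'ced9', the M70 CeH₉ parent @120 column 'ceh9@120'): `ephOnly_hf_led`
  (an «UND:HF(…)»-LED print — the f-door D-line of M70 rows 267 / 268 — is `PARTIAL` iff «EPH» rides, else `DISAGREE`),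
  `ephOnly_hf_led_ne_agree` (never `AGREE`: the pre-named «informative f-door tension, never a defect» of R-abr (2)),
  `ephOnly_word_identical` (a byref twin whose word is the parent's by construction scores as the parent), `block62_table` (the
  desk check of 06:53Z by `decide`).
* §3 the v7 pair: M198 under MONO «UND:MULTIORB» (`block64_m198_table`; `mono_dstraddle_led` — a Ru-4d straddle head is `PARTIAL`
  iff the k-head rides, else `DISAGREE`, never `AGREE`) and M197 under the FILM PAIR «UND:MULTIORB ∣ UND:MULTIORB+UND:STRUCT»
  (`filmPair`, `score_filmPair_eq_mono` — the compound word is dominated ⇒ ≡ MONO on every print, `score_filmPair` closed form,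
  `filmPair_agree_iff` — `AGREE` iff LED by the k-head, `filmPair_struct_rider_agree` / `filmPair_struct_led_abstain` — «UND:STRUCT»
  typed only as a SECONDARY: riding it is `AGREE`, leading it abstains, `filmPair_bh1_led_ne_agree` — the infinite-layer «1BH(+3BE)»
  reading is never `AGREE` here although the NICKELATE TRIPLE of p814034 would read it `AGREE`: the typing decides, stated side by
  side in `film_vs_nickelateTriple_bh1`), `block64_m197_table` (desk check 07:48Z by `decide`).
* §4 the receipt classes of the five objects (`heldSlate_tranches`: M178 / M179 v5, M70 v2, M198 / M197 v7 ⇒ all PREVIEW, receipted,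
  never pooled with R, no MO-PRED tick) and `heldSlate_no_tick` (appending all five rows, first words or not, to ANY ledger leaves the
  MO-PRED-1 first-word tally unchanged — the 1.24 tally cannot move on the HELD slate).

WHAT THIS IS NOT: not a typing ruling (the curators' truth files fix the alternatives; the DFT+U_f / La-proxy members of the Ce
skeleton are CONTEXT and never score), not the scorer of record (router_score.py / deputy-2 score.py are), not a GO on any held
object, and not a statement about Ce-4f, ruthenate or nickelate physics.
-/

namespace Summit.Ventures.CertifiedManyBodySolver.Downfold

namespace RouterScore

/-! ## §1 «q ∣ q+s»: a bare primary and the same primary with one typed rider, any head alphabet -/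

section general

variable {α : Type*} [DecidableEq α] (structural : α → Bool)

/-- THE BARE-WITH-RIDER PAIR ≡ THE BARE WORD: «q ∣ q+s» scores every print like «q» (the compound alternative is dominated by the
bare one). [folklore] -/
theorem outcome_bare_with_rider (e : List α) (q s : α) :
    outcome structural e [[q], [q, s]] = outcome structural e [[q]] :=
  outcome_append_redundant structural e (alts := [[q]]) (by simp) (dominates_head_cons q [s])

/-- … in closed form for a non-structural `q`: structural-led ⇒ ABSTAIN(structure) · led by `q` ⇒ AGREE whatever rides (in
particular with `s` riding) · `q` riding ⇒ PARTIAL · `q` absent ⇒ DISAGREE. [folklore] -/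
theorem outcome_bare_with_rider_closed (p q s : α) (tl : List α) (hq : structural q = false) :
    outcome structural (p :: tl) [[q], [q, s]] =
      (if structural p then .ABSTAIN_structure
       else if p = q then .AGREE
       else if q ∈ tl then .PARTIAL else .DISAGREE) := by
  rw [outcome_bare_with_rider]
  exact outcome_singleton structural p q tl hq

/-- … hence AGREE iff LED by `q`. [folklore] -/
theorem bare_with_rider_agree_iff (p q s : α) (tl : List α) (hq : structural q = false) :
    outcome structural (p :: tl) [[q], [q, s]] = .AGREE ↔ p = q := by
  rw [outcome_bare_with_rider]
  exact singleton_agree_iff structural p q tl hq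

end general

open Head

/-! ## §2 The Ce pair under EPH-ONLY (block62: M178 CeH₁₀ @95 'ceh10', M179 CeD₉ @120 'ced9', M70 CeH₉ parent @120 'ceh9@120') -/

/-- THE f-DOOR LINE under EPH-ONLY: an «UND:HF(w_f=…; Kondo lattice; no S2 instrument)»-LED print (the M70 CeH₉ @88 / @130 head of
WORDS rows 267 / 268) is `PARTIAL` iff «EPH» rides behind it, else `DISAGREE`. [folklore] -/
theorem ephOnly_hf_led (tl : List Head) :
    score (undHF :: tl) ephOnly = (if eph ∈ tl then .PARTIAL else .DISAGREE) := by
  rw [score_ephOnly, if_neg (by decide), if_neg (by decide)]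

/-- … and is NEVER `AGREE` — the pre-named expected outcome «DISAGREE as printed = the informative f-door tension, never a defect,
no rescue» (lead g40 R-abr (2)); the only AGREE shape under EPH-ONLY is an «EPH»-LED print (`ephOnly_agree_iff` p750409). [folklore] -/
theorem ephOnly_hf_led_ne_agree (tl : List Head) : score (undHF :: tl) ephOnly ≠ .AGREE := by
  rw [Ne, ephOnly_agree_iff]; decide

/-- the rider-less f-door print ⇒ `DISAGREE`; with «EPH» appended by the reader (r45) ⇒ `PARTIAL` (`eph_rider_partial` p752867). [folklore] -/
theorem ephOnly_hf_bare_and_rider (r : List Head) :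
    score [undHF] ephOnly = .DISAGREE ∧ score (undHF :: eph :: r) ephOnly = .PARTIAL := by
  refine ⟨by decide, ?_⟩
  rw [ephOnly_hf_led, if_pos List.mem_cons_self]

/-- A BYREF TWIN scores as its parent: M179 CeD₉ @120 is worded BY REFERENCE to the CeH₉ #81 parent @120 column («the twin's word ≡
the parent's @120 word by construction; no parent ⇒ no twin», R-abs (B)) ⇒ the two receipts carry the same verdict, whatever the
word. Stated for any typing. [folklore] -/
theorem score_word_identical {e_parent e_twin : List Head} (alts : List (List Head)) (h : e_twin = e_parent) :
    score e_twin alts = score e_parent alts := by rw [h]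

/-- The block62 desk check by `decide` (score-2 g24 06:53Z on `e1bdba9428d18f1c`; lead g41 ACK l.11443 ≡): «UND:HF» DISAGREE ·
«UND:HF+EPH» / «UND:MIXED+EPH» PARTIAL · «EPH» / «EPH+UND:HF» AGREE · «BI» DISAGREE · «UND:STRUCT+UND:HF» / «UND:DISPUTED+UND:HF»
ABSTAIN(structure) (not printable on `structure.status = established`: R0 silent). [folklore] -/
theorem block62_table :
    score [undHF] ephOnly = .DISAGREE ∧
    score [undHF, eph] ephOnly = .PARTIAL ∧ score [undMixed, eph] ephOnly = .PARTIAL ∧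
    score [eph] ephOnly = .AGREE ∧ score [eph, undHF] ephOnly = .AGREE ∧
    score [bi] ephOnly = .DISAGREE ∧
    score [undStruct, undHF] ephOnly = .ABSTAIN_structure ∧ score [undDisputed, undHF] ephOnly = .ABSTAIN_structure := by
  decide

/-- The Ce precedents of record under EPH-ONLY: M70 CeH₉ @88 / @130 (WORDS rows 267 / 268, v2) printed the bare f-door head ⇒
DISAGREE ×2; the hydride «EPH(+riders)» rows of the Th–H / Y–H / La–H packages ⇒ AGREE. [folklore] -/
theorem ce_precedents : score [undHF] ephOnly = .DISAGREE ∧ score [eph] ephOnly = .AGREE ∧ score [eph, sa] ephOnly = .AGREE := by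
  decide

/-! ## §3 The v7 pair (block64): M198 Sr₂RuO₄-strain100 under MONO, M197 La₃Ni₂O₇-filmSLAO under the FILM PAIR -/

/-- Under MONO «UND:MULTIORB» a D3-STRADDLE-LED print «UND:MIXED(m_μB[Ru] straddles θ_m …)+…» (the RuO₂-film M191 shape, pre-named
at-risk shape (a) of block64 for M198) is `PARTIAL` iff the k-head rides, else `DISAGREE` … [folklore] -/
theorem mono_dstraddle_led (tl : List Head) :
    score (undMixed :: tl) mono = (if undMultiorb ∈ tl then .PARTIAL else .DISAGREE) := by
  rw [score_mono_direct, if_neg (by decide), if_neg (by decide)]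

/-- … and never `AGREE`; likewise an «EPH»-led or «1BH»-led print (shapes (b) / (c)): under MONO only the k-head in front is `AGREE`
(`score_mono` p744404 / `mono_pair_agree_iff` p750409). [folklore] -/
theorem mono_ne_agree_of_ne_khead (p : Head) (tl : List Head) (hp : p ≠ undMultiorb) : score (p :: tl) mono ≠ .AGREE := by
  show ¬ (outcome Head.structural (p :: tl) [[undMultiorb]] = .AGREE)
  rw [singleton_agree_iff Head.structural p undMultiorb tl rfl]; exact hp

/-- The block64 desk check for M198 by `decide` (score-2 g24 07:48Z on `deed1d82518e3e2d`; lead g41 ACK l.11475 ≡): «UND:MULTIORB+EPH» /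
«UND:MULTIORB» AGREE · «UND:MIXED+UND:MULTIORB+EPH» / «EPH+UND:MULTIORB» PARTIAL · «UND:MIXED+EPH» / «EPH» / «1BH» DISAGREE ·
«UND:STRUCT+UND:MULTIORB» ABSTAIN(structure); and the PAIR sentence with M48 Sr₂RuO₄ @0 (rows 72 / 119 print the k-head with «EPH»
riding ⇒ AGREE — a word-identical pair is verdict-identical, `mono_riders_immaterial` p750409). [folklore] -/
theorem block64_m198_table :
    score [undMultiorb, eph] mono = .AGREE ∧ score [undMultiorb] mono = .AGREE ∧
    score [undMixed, undMultiorb, eph] mono = .PARTIAL ∧ score [eph, undMultiorb] mono = .PARTIAL ∧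
    score [undMixed, eph] mono = .DISAGREE ∧ score [eph] mono = .DISAGREE ∧ score [bh1] mono = .DISAGREE ∧
    score [undStruct, undMultiorb] mono = .ABSTAIN_structure := by
  decide

/-- the typing of v7 M197 La₃Ni₂O₇-filmSLAO (bilayer film clamped on SrLaAlO₄(001); structure variant of M23):
«UND:MULTIORB ∣ UND:MULTIORB+UND:STRUCT» — the k-head bare, and the k-head with the clamped-film STRUCTURE token typed as a
SECONDARY. [folklore] -/
def filmPair : List (List Head) := [[undMultiorb], [undMultiorb, undStruct]]

/-- THE FILM PAIR ≡ MONO on every print (the compound word is dominated by the bare k-head). [folklore] -/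
theorem score_filmPair_eq_mono (e : List Head) : score e filmPair = score e mono :=
  outcome_bare_with_rider Head.structural e undMultiorb undStruct

/-- THE FILM PAIR IN CLOSED FORM: structural-LED ⇒ ABSTAIN(structure); led by «UND:MULTIORB» ⇒ AGREE whatever rides («+UND:STRUCT»,
«+EPH», a second site group); the k-head riding behind another head ⇒ PARTIAL; no k-head ⇒ DISAGREE. [folklore] -/
theorem score_filmPair (p : Head) (tl : List Head) :
    score (p :: tl) filmPair =
      (if p.structural then .ABSTAIN_structure
       else if p = undMultiorb then .AGREE
       else if undMultiorb ∈ tl then .PARTIAL else .DISAGREE) :=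
  outcome_bare_with_rider_closed Head.structural p undMultiorb undStruct tl rfl

/-- `AGREE` iff the print is LED by «UND:MULTIORB» (= M23's rows 154–156 / 439 and M263's: the identical-pair expectation R20e / R20i). [folklore] -/
theorem filmPair_agree_iff (p : Head) (tl : List Head) : score (p :: tl) filmPair = .AGREE ↔ p = undMultiorb :=
  bare_with_rider_agree_iff Head.structural p undMultiorb undStruct tl rfl

/-- «UND:STRUCT» is typed only as a SECONDARY: RIDING behind the k-head it is `AGREE` (with or without further riders) … [folklore] -/
theorem filmPair_struct_rider_agree (r : List Head) : score (undMultiorb :: undStruct :: r) filmPair = .AGREE :=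
  (filmPair_agree_iff undMultiorb (undStruct :: r)).2 rfl

/-- … while a structure-LED print «UND:STRUCT(clamped film …)+UND:MULTIORB(…)» ABSTAINS (no alternative expects a structural
PRIMARY: `outcome_structural_abstain`) — pre-named shape (d) of block64. [folklore] -/
theorem filmPair_struct_led_abstain (tl : List Head) : score (undStruct :: tl) filmPair = .ABSTAIN_structure := by
  rw [score_filmPair, if_pos (show undStruct.structural = true from rfl)]

/-- The infinite-layer / T′ reading «1BH(+3BE)…» LEADING (pre-named shape (b): a bilayer WITH apical O read as one-band) is never
`AGREE` under the FILM PAIR — `PARTIAL` iff the k-head rides, else `DISAGREE` … [folklore] -/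
theorem filmPair_bh1_led (tl : List Head) :
    score (bh1 :: tl) filmPair = (if undMultiorb ∈ tl then .PARTIAL else .DISAGREE) := by
  rw [score_filmPair, if_neg (by decide), if_neg (by decide)]

/-- … whereas the NICKELATE TRIPLE «1BH ∣ 1BH+UND:MULTIORB ∣ UND:MULTIORB» of p814034 (the typing of the T′ objects M125 / M330 / M331,
NOT of this RP bilayer film) reads the same print `AGREE`: THE TYPING DECIDES, and the curators typed the film like the bulk M23. [folklore] -/
theorem film_vs_nickelateTriple_bh1 (tl : List Head) :
    score (bh1 :: tl) filmPair ≠ .AGREE ∧ score (bh1 :: tl) nickelateTriple = .AGREE := by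
  refine ⟨?_, nickelateTriple_bh1_led tl⟩
  rw [Ne, filmPair_agree_iff]; decide

/-- a Ni-site D3 STRADDLE head with the k-head riding (the La₄Ni₃O₁₀ M40 @0 inner-site shape; pre-named shape (a)) ⇒ `PARTIAL`;
rider-less ⇒ `DISAGREE`. [folklore] -/
theorem filmPair_dstraddle (r : List Head) :
    score (undMixed :: undMultiorb :: r) filmPair = .PARTIAL ∧ score [undMixed] filmPair = .DISAGREE := by
  refine ⟨?_, by decide⟩
  rw [score_filmPair, if_neg (by decide), if_neg (by decide), if_pos List.mem_cons_self]

/-- The block64 desk check for M197 by `decide` (score-2 g24 07:48Z; lead g41 ACK l.11475 ≡): «UND:MULTIORB» / «UND:MULTIORB+UND:STRUCT» /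
«UND:MULTIORB+EPH» AGREE · «UND:MIXED+UND:MULTIORB» / «1BH+UND:MULTIORB» PARTIAL · «UND:MIXED» / «1BH+3BE» / «EPH» DISAGREE ·
«UND:STRUCT+UND:MULTIORB» ABSTAIN(structure); and M23's bulk print «UND:MULTIORB+bilayer-1BH» (RouterWordScore §5 case) ⇒ AGREE — the
PAIR sentence with M23 @0. [folklore] -/
theorem block64_m197_table :
    score [undMultiorb] filmPair = .AGREE ∧ score [undMultiorb, undStruct] filmPair = .AGREE ∧
    score [undMultiorb, eph] filmPair = .AGREE ∧
    score [undMixed, undMultiorb] filmPair = .PARTIAL ∧ score [bh1, undMultiorb] filmPair = .PARTIAL ∧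
    score [undMixed] filmPair = .DISAGREE ∧ score [bh1, be3] filmPair = .DISAGREE ∧ score [eph] filmPair = .DISAGREE ∧
    score [undStruct, undMultiorb] filmPair = .ABSTAIN_structure ∧
    score [undMultiorb, bilayer1bh] filmPair = .AGREE := by
  decide

/-! ## §4 Receipt classes of the held slate: five PREVIEW receipts, no R pooling, no MO-PRED-1 tick -/

/-- the tranches of the five held objects: M178 / M179 v5 · M70 (the CeH₉ parent) v2 · M198 / M197 v7 — every one a PREVIEW-class id
(receipted on its stamp into its own tranche table, never pooled with the R tally of record, no MO-PRED-1 tick). [folklore] -/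
theorem heldSlate_tranches :
    trancheOf 178 = .v5 ∧ trancheOf 179 = .v5 ∧ trancheOf 70 = .v2 ∧ trancheOf 198 = .v7 ∧ trancheOf 197 = .v7 ∧
    (trancheOf 178).preview = true ∧ (trancheOf 179).preview = true ∧ (trancheOf 70).preview = true ∧
    (trancheOf 198).preview = true ∧ (trancheOf 197).preview = true ∧
    (trancheOf 178).mopredCounts = false ∧ (trancheOf 179).mopredCounts = false ∧ (trancheOf 70).mopredCounts = false ∧
    (trancheOf 198).mopredCounts = false ∧ (trancheOf 197).mopredCounts = false := by
  decide

/-- none of the five is a v8 id. [folklore] -/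
theorem heldSlate_ne_v8 :
    trancheOf 178 ≠ .v8 ∧ trancheOf 179 ≠ .v8 ∧ trancheOf 70 ≠ .v8 ∧ trancheOf 198 ≠ .v8 ∧ trancheOf 197 ≠ .v8 := by
  decide

/-- THE 1.24 TALLY CANNOT MOVE ON THE HELD SLATE: appending the five rows — in the letter's order M178, M70 @120 (parent first),
M179 (twin), M198, M197; first words or further columns, twin flag as the ledger sets it — to ANY MO-PRED ledger leaves the
first-word tally unchanged (`fwTally_append_rowOf_of_ne_v8` p812838, five times). [folklore] -/
theorem heldSlate_no_tick (evs : List WordRow) (f₁ f₂ f₃ f₄ f₅ t₁ t₂ t₃ t₄ t₅ : Bool) :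
    fwTally (evs ++ [rowOf 178 f₁ t₁] ++ [rowOf 70 f₂ t₂] ++ [rowOf 179 f₃ t₃] ++ [rowOf 198 f₄ t₄] ++ [rowOf 197 f₅ t₅]) =
      fwTally evs := by
  obtain ⟨h178, h179, h70, h198, h197⟩ := heldSlate_ne_v8
  rw [fwTally_append_rowOf_of_ne_v8 _ h197, fwTally_append_rowOf_of_ne_v8 _ h198, fwTally_append_rowOf_of_ne_v8 _ h179,
    fwTally_append_rowOf_of_ne_v8 _ h70, fwTally_append_rowOf_of_ne_v8 _ h178]

/-- … in particular on the ledger of record `rows124` (tally 8 after WORDS row 933, p812838): still 8, clause (A) at 15 still false. [folklore] -/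
theorem mopred124_after_heldSlate (f₁ f₂ f₃ f₄ f₅ t₁ t₂ t₃ t₄ t₅ : Bool) :
    fwTally (rows124 ++ [rowOf 193 true false] ++ [rowOf 178 f₁ t₁] ++ [rowOf 70 f₂ t₂] ++ [rowOf 179 f₃ t₃] ++ [rowOf 198 f₄ t₄] ++
      [rowOf 197 f₅ t₅]) = 8 := by
  rw [heldSlate_no_tick, mopred124_after_yptbi]

end RouterScore

end Summit.Ventures.CertifiedManyBodySolver.Downfold
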